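import Summits.NavierStokesRegularity.NavierStokesRegularity.Theorems.LerayQuarterDissipationFiniteDissipationLiouvilleApexDecay
import HarnessLib

/-!
# Crux `FiniteDissipationLiouville` (stmt-NavierStokesRegularity-22144): slice Hölder tools for the
# finite-singular-set leaf (file 2/3)

Theorems file of route `LerayQuarterDissipation` (lead prover g4; `--supports` the crux). Pure
measure theory, no Navier–Stokes: the one-line Hölder inequalities by which the CKN quantity
`∫∫ (|u|³ + |p|^{3/2})` over the union `E` of `N` disjoint small balls is paid for by GLOBAL slice
norms with the factor `|E|^{1/2} ∼ √N` (and not `N`) — the gain that makes the final-time singular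
set of a member of the finite-dissipation stratum FINITE (file 3/3). Navier–Stokes regularity is
NOT proved by anything here; no summit is.

* `setLIntegral_le_sqrt_mul_sqrt` — `∫_E f ≤ (∫_E f²)^{1/2} |E|^{1/2}` (Cauchy–Schwarz).
* `setLIntegral_enorm_cube_le` — `∫_E |v|³ ≤ ‖v‖_{L⁶}³ |E|^{1/2}`.
* `setLIntegral_enorm_rpow_threeHalves_le` — `∫_E |Q|^{3/2} ≤ ‖Q‖_{L³}^{3/2} |E|^{1/2}`.
* `setLIntegral_enorm_rpow_threeHalves_add_const_le` — for a gauged pressure slice `pr = Q + c`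
  a.e.: `∫_E |pr|^{3/2} ≤ 2^{1/2} (‖Q‖_{L³}^{3/2} |E|^{1/2} + |c|^{3/2} |E|)`.
* `setLIntegral_prod_le_lintegral_lintegral` — Tonelli's inequality on a product set (no
  measurability needed).
* `lintegral_Ioo_rpow_neg_threeQuarters` — `∫_{−a}^{0} (−t)^{−3/4} dt = 4 a^{1/4}`, the time
  integral of the Type-I slice rate.
-/

noncomputable section

-- the summit and its single sub-problem share the name (CONVENTIONS §1), as in every Theorems file
set_option linter.dupNamespace false

namespace Summit.NavierStokesRegularity.NavierStokesRegularity.Theorems.FiniteDissipationLiouville.Birth.Apex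

open MeasureTheory Set Filter Topology Metric Function
open scoped ENNReal NNReal

/-! ### Cauchy–Schwarz on a set of finite measure -/

/-- **Cauchy–Schwarz on a set**: `∫_E f ≤ (∫_E f²)^{1/2} μ(E)^{1/2}` for a.e.-measurable
`f : α → ℝ≥0∞`. -/
theorem setLIntegral_le_sqrt_mul_sqrt {α : Type*} [MeasurableSpace α] {μ : Measure α}
    {E : Set α} {f : α → ℝ≥0∞} (hf : AEMeasurable f (μ.restrict E)) :
    ∫⁻ x in E, f x ∂μ ≤ (∫⁻ x in E, f x ^ (2 : ℝ) ∂μ) ^ (1 / 2 : ℝ) * (μ E) ^ (1 / 2 : ℝ) := by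
  have h := ENNReal.lintegral_mul_le_Lp_mul_Lq (μ.restrict E) Real.HolderConjugate.two_two hf
    (aemeasurable_const (b := (1 : ℝ≥0∞)))
  simp only [Pi.mul_apply, mul_one, ENNReal.one_rpow, lintegral_const, Measure.restrict_apply_univ,
    one_mul] at h
  exact h

/-! ### The velocity slice: `∫_E |v|³ ≤ ‖v‖₆³ |E|^{1/2}` -/

/-- **Hölder for the cube on a set**: `∫_E |v|³ ≤ ‖v‖_{L⁶(ℝ³)}³ · |E|^{1/2}` for an
a.e.-strongly measurable field `v`. -/
theorem setLIntegral_enorm_cube_le {v : EuclideanSpace ℝ (Fin 3) → EuclideanSpace ℝ (Fin 3)}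
    (hv : AEStronglyMeasurable v volume) (E : Set (EuclideanSpace ℝ (Fin 3))) :
    ∫⁻ x in E, ‖v x‖ₑ ^ (3 : ℕ) ≤
      eLpNorm v (ENNReal.ofReal 6) volume ^ (3 : ℝ) * (volume E) ^ (1 / 2 : ℝ) := by
  have hf : AEMeasurable (fun x => ‖v x‖ₑ ^ (3 : ℕ)) (volume.restrict E) :=
    (hv.enorm.pow_const 3).restrict
  refine (setLIntegral_le_sqrt_mul_sqrt hf).trans ?_
  gcongr
  have e2 : ∀ x, (‖v x‖ₑ ^ (3 : ℕ)) ^ (2 : ℝ) = ‖v x‖ₑ ^ 6 := fun x => by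
    rw [ENNReal.rpow_two, ← pow_mul]
  simp_rw [e2]
  calc (∫⁻ x in E, ‖v x‖ₑ ^ 6) ^ (1 / 2 : ℝ) ≤ (∫⁻ x, ‖v x‖ₑ ^ 6) ^ (1 / 2 : ℝ) := by
        gcongr
        exact Measure.restrict_le_self
    _ = eLpNorm v (ENNReal.ofReal 6) volume ^ (3 : ℝ) := by
        rw [lintegral_enorm_pow_six_eq hv, ← ENNReal.rpow_mul]
        norm_num

/-! ### The pressure slice: `∫_E |Q|^{3/2} ≤ ‖Q‖₃^{3/2} |E|^{1/2}` -/

/-- **Hölder for the `3/2` power on a set**: `∫_E |Q|^{3/2} ≤ ‖Q‖_{L³(ℝ³)}^{3/2} · |E|^{1/2}` for an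
a.e.-strongly measurable scalar `Q`. -/
theorem setLIntegral_enorm_rpow_threeHalves_le {Q : EuclideanSpace ℝ (Fin 3) → ℝ}
    (hQ : AEStronglyMeasurable Q volume) (E : Set (EuclideanSpace ℝ (Fin 3))) :
    ∫⁻ x in E, ‖Q x‖ₑ ^ (3 / 2 : ℝ) ≤
      eLpNorm Q 3 volume ^ (3 / 2 : ℝ) * (volume E) ^ (1 / 2 : ℝ) := by
  have hf : AEMeasurable (fun x => ‖Q x‖ₑ ^ (3 / 2 : ℝ)) (volume.restrict E) :=
    (hQ.enorm.pow_const _).restrict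
  refine (setLIntegral_le_sqrt_mul_sqrt hf).trans ?_
  gcongr
  have e2 : ∀ x, (‖Q x‖ₑ ^ (3 / 2 : ℝ)) ^ (2 : ℝ) = ‖Q x‖ₑ ^ (3 : ℝ) := fun x => by
    rw [← ENNReal.rpow_mul]; norm_num
  simp_rw [e2]
  have e3 : ∫⁻ x, ‖Q x‖ₑ ^ (3 : ℝ) = eLpNorm Q 3 volume ^ (3 : ℝ) := by
    rw [lintegral_rpow_enorm_eq_rpow_eLpNorm' (by norm_num : (0 : ℝ) < 3),
      eLpNorm_eq_eLpNorm' (by norm_num) (by norm_num)]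
    norm_num
  calc (∫⁻ x in E, ‖Q x‖ₑ ^ (3 : ℝ)) ^ (1 / 2 : ℝ) ≤ (∫⁻ x, ‖Q x‖ₑ ^ (3 : ℝ)) ^ (1 / 2 : ℝ) := by
        gcongr
        exact Measure.restrict_le_self
    _ = eLpNorm Q 3 volume ^ (3 / 2 : ℝ) := by
        rw [e3, ← ENNReal.rpow_mul]
        norm_num

/-! ### The gauged pressure slice `pr = Q + c` -/

/-- **The gauged pressure slice.** If `pr = Q + c` a.e. for a constant `c`, then
`∫_E |pr|^{3/2} ≤ 2^{1/2} (‖Q‖_{L³}^{3/2} |E|^{1/2} + |c|^{3/2} |E|)`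
(`(a + b)^{3/2} ≤ 2^{1/2}(a^{3/2} + b^{3/2})` and the two previous bounds). -/
theorem setLIntegral_enorm_rpow_threeHalves_add_const_le {pr Q : EuclideanSpace ℝ (Fin 3) → ℝ}
    {c : ℝ} (hQ : AEStronglyMeasurable Q volume)
    (hae : ∀ᵐ x ∂(volume : Measure (EuclideanSpace ℝ (Fin 3))), pr x = Q x + c)
    (E : Set (EuclideanSpace ℝ (Fin 3))) :
    ∫⁻ x in E, ‖pr x‖ₑ ^ (3 / 2 : ℝ) ≤
      (2 : ℝ≥0∞) ^ (1 / 2 : ℝ) *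
        (eLpNorm Q 3 volume ^ (3 / 2 : ℝ) * (volume E) ^ (1 / 2 : ℝ) +
          ‖c‖ₑ ^ (3 / 2 : ℝ) * volume E) := by
  have hae' : ∀ᵐ x ∂(volume.restrict E), ‖pr x‖ₑ ^ (3 / 2 : ℝ) ≤
      (2 : ℝ≥0∞) ^ (1 / 2 : ℝ) * (‖Q x‖ₑ ^ (3 / 2 : ℝ) + ‖c‖ₑ ^ (3 / 2 : ℝ)) := by
    filter_upwards [ae_restrict_of_ae hae] with x hx
    rw [hx]
    calc ‖Q x + c‖ₑ ^ (3 / 2 : ℝ) ≤ (‖Q x‖ₑ + ‖c‖ₑ) ^ (3 / 2 : ℝ) := by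
          gcongr
          exact enorm_add_le _ _
      _ ≤ (2 : ℝ≥0∞) ^ ((3 / 2 : ℝ) - 1) * (‖Q x‖ₑ ^ (3 / 2 : ℝ) + ‖c‖ₑ ^ (3 / 2 : ℝ)) :=
          ENNReal.rpow_add_le_mul_rpow_add_rpow _ _ (by norm_num)
      _ = (2 : ℝ≥0∞) ^ (1 / 2 : ℝ) * (‖Q x‖ₑ ^ (3 / 2 : ℝ) + ‖c‖ₑ ^ (3 / 2 : ℝ)) := by
          norm_num
  have hfQ : AEMeasurable (fun x => ‖Q x‖ₑ ^ (3 / 2 : ℝ)) (volume.restrict E) :=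
    (hQ.enorm.pow_const _).restrict
  calc ∫⁻ x in E, ‖pr x‖ₑ ^ (3 / 2 : ℝ)
      ≤ ∫⁻ x in E, (2 : ℝ≥0∞) ^ (1 / 2 : ℝ) * (‖Q x‖ₑ ^ (3 / 2 : ℝ) + ‖c‖ₑ ^ (3 / 2 : ℝ)) :=
        lintegral_mono_ae hae'
    _ = (2 : ℝ≥0∞) ^ (1 / 2 : ℝ) *
          ((∫⁻ x in E, ‖Q x‖ₑ ^ (3 / 2 : ℝ)) + ∫⁻ _ in E, ‖c‖ₑ ^ (3 / 2 : ℝ)) := by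
        rw [lintegral_const_mul' _ _ (by simp), lintegral_add_left' hfQ]
    _ ≤ (2 : ℝ≥0∞) ^ (1 / 2 : ℝ) *
          (eLpNorm Q 3 volume ^ (3 / 2 : ℝ) * (volume E) ^ (1 / 2 : ℝ) +
            ‖c‖ₑ ^ (3 / 2 : ℝ) * volume E) := by
        rw [setLIntegral_const]
        gcongr
        exact setLIntegral_enorm_rpow_threeHalves_le hQ E

/-! ### Tonelli's inequality on a product set -/

/-- **Tonelli's inequality on a product set** (no measurability needed):
`∫∫_{I × E} F ≤ ∫_I ∫_E F(t, x) dx dt`. -/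
theorem setLIntegral_prod_le_lintegral_lintegral (I : Set ℝ) (E : Set (EuclideanSpace ℝ (Fin 3)))
    (F : ℝ × EuclideanSpace ℝ (Fin 3) → ℝ≥0∞) :
    ∫⁻ z in I ×ˢ E, F z ≤ ∫⁻ t in I, ∫⁻ x in E, F (t, x) := by
  rw [volume_restrict_prod_eq]
  exact lintegral_prod_le _

/-! ### The time integral of the slice rate -/

/-- **The time integral of the Type-I slice rate**: `∫_{−a}^{0} (−t)^{−3/4} dt = 4 a^{1/4}` for
`a > 0`, in `ℝ≥0∞` form. -/
theorem lintegral_Ioo_rpow_neg_threeQuarters {a : ℝ} (ha : 0 < a) :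
    ∫⁻ t in Ioo (-a) 0, ENNReal.ofReal ((-t) ^ (-(3 / 4 : ℝ))) =
      ENNReal.ofReal (4 * a ^ (1 / 4 : ℝ)) := by
  have hII : IntervalIntegrable (fun x : ℝ => x ^ (-(3 / 4 : ℝ))) volume a 0 :=
    intervalIntegral.intervalIntegrable_rpow' (by norm_num)
  have hc := hII.comp_sub_left 0
  simp only [zero_sub, sub_zero] at hc
  have hint : IntegrableOn (fun t : ℝ => (-t) ^ (-(3 / 4 : ℝ))) (Ioo (-a) 0) :=
    (hc.1 : IntegrableOn (fun t : ℝ => (-t) ^ (-(3 / 4 : ℝ))) (Ioc (-a) 0)).mono_set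
      Ioo_subset_Ioc_self
  have hnn : 0 ≤ᵐ[volume.restrict (Ioo (-a) 0)] fun t : ℝ => (-t) ^ (-(3 / 4 : ℝ)) := by
    filter_upwards [ae_restrict_mem measurableSet_Ioo] with t ht
    exact Real.rpow_nonneg (by linarith [ht.2]) _
  rw [← ofReal_integral_eq_lintegral_ofReal hint hnn]
  congr 1
  rw [← integral_Ioc_eq_integral_Ioo, ← intervalIntegral.integral_of_le (by linarith : -a ≤ 0)]
  have h := intervalIntegral.integral_comp_neg (a := -a) (b := 0)
    (f := fun x : ℝ => x ^ (-(3 / 4 : ℝ)))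
  simp only [neg_neg, neg_zero] at h
  rw [h, integral_rpow (Or.inl (by norm_num))]
  have e1 : (-(3 / 4 : ℝ)) + 1 = 1 / 4 := by norm_num
  rw [e1, Real.zero_rpow (by norm_num)]
  ring

end Summit.NavierStokesRegularity.NavierStokesRegularity.Theorems.FiniteDissipationLiouville.Birth.Apex

end
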